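import Summits.AtomisticToContinuum.Crystallization.Theorems.PerronTransitivityUniformBindingRigidityCohesionM
import Summits.AtomisticToContinuum.Crystallization.Theorems.PerronTransitivityUniformBindingRigiditySepBootstrap

/-!
# Cohesion of uniformly bound Lennard-Jones configurations, XV: the separation bootstrap at `23/40`

Helper file (`--supports stmt-AtomisticToContinuum-15099`) of the registered stub
`stub_localHalfSpaceCert` (= `(LOCAL)`, stated at separation `9/20`) of the line `registered` of the
crux `Summit.AtomisticToContinuum.Crystallization.Theses.PerronTransitivity.UniformBindingRigidity`
(item stmt-AtomisticToContinuum-15099).  Notation `U_Y(p) = Σ'_{q ∈ Y, q ≠ p} V_LJ(dist p q)`,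
`T(δ, R) = 16/(δ³R³) + 18/(δ²R⁴) + 36/(5δR⁵) + 1/R⁶` (the sharp tail of parts XIII–XIV).

The landed bootstrap `(SEP)` (`stub_sepBootstrap`, file `…SepBootstrap.lean`: uniformly
`(−711/500)`-bound `1/4`-separated sets are `9/20`-separated) is the infimum-of-distances argument
of part I with the tail constant `1024` at radius `5/2`; that constant is what stops it at `9/20`
(the same inequality fails from `m ≈ 0.49` on).  With the sharp truncation of part XIV at radius
`13/10` the identical argument runs up to `m ≈ 0.586`; this file certifies it up to `23/40 = 0.575`:

* §27 `sharpTail_anti` (`T(·, R)` is antitone in the separation) and the endpoint numerics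
  `sepSharp_numerics` on `[9/20, 1/2] ∪ [1/2, 11/20] ∪ [11/20, 113/200] ∪ [113/200, 23/40]`
  (margins `> 100, 10, 7, 3`);
* §28 `sepSharp` — a `9/20`-separated `Y ⊆ ℝ³` all of whose site sums are `≤ −711/500` is
  `23/40`-separated (registered as `stub_local_sepSharp`), and with `(SEP)` the composite
  `sep_of_quarter_sharp`: uniformly `(−711/500)`-bound `1/4`-separated sets are `23/40`-separated.

Use: `(LOCAL)` may be RESHAPED to separation `23/40` (a weaker, more certifiable statement: the
maximal density of the competitor drops by `(18/23)³ ≈ 0.48`), the composition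
`(CORE) ⇐ (SEP) ∧ (SEP♯) ∧ (LOCAL at 23/40)` being unchanged.  Beyond `≈ 0.6` single-site bootstraps
stop (an over-packed single site IS bound below `−711/500` at separation `≤ 0.8`, part II).
All `[folklore]`.
-/

noncomputable section

namespace Summit.AtomisticToContinuum.Crystallization.Theorems.PerronTransitivityUniformBindingRigidity

open scoped BigOperators Topology
open Filter Set Metric
open Literature.MathematicalPhysics.StatisticalMechanics
open Summit.AtomisticToContinuum.Crystallization.Theorems.ChargedEnergyGapNegative (E3)

/-! ## §27 Numerics of the sharp bootstrap -/

/-- The sharp tail `T(δ, R)` is antitone in the separation `δ`. [folklore] -/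
theorem sharpTail_anti {a m R : ℝ} (ha : 0 < a) (ham : a ≤ m) (hR : 0 < R) :
    16 / (m ^ 3 * R ^ 3) + 18 / (m ^ 2 * R ^ 4) + 36 / (5 * m * R ^ 5) + 1 / R ^ 6 ≤
      16 / (a ^ 3 * R ^ 3) + 18 / (a ^ 2 * R ^ 4) + 36 / (5 * a * R ^ 5) + 1 / R ^ 6 := by
  gcongr

/-- **Numerics of the sharp bootstrap.** For `9/20 ≤ m ≤ 23/40`:
`m⁻⁶/6 + ((13/5)/m + 1)³ − 2)/12 + T(m, 13/10)/6 − 711/500 < (1/12)(2m¹²)⁻¹`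
(four cases; every term is monotone in `m` and is bounded at the unfavourable endpoint of its
interval). [folklore] -/
theorem sepSharp_numerics {m : ℝ} (h1 : 9 / 20 ≤ m) (h2 : m ≤ 23 / 40) :
    1 / 6 * m⁻¹ ^ 6 + 1 / 12 * ((2 * (13 / 10) / m + 1) ^ 3 - 2) +
        1 / 6 * (16 / (m ^ 3 * (13 / 10) ^ 3) + 18 / (m ^ 2 * (13 / 10) ^ 4) +
          36 / (5 * m * (13 / 10) ^ 5) + 1 / (13 / 10 : ℝ) ^ 6) - 711 / 500 <
      1 / 12 * (2 * m ^ 12)⁻¹ := by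
  have hm0 : 0 < m := by linarith
  have h13 : (0 : ℝ) < 13 / 10 := by norm_num
  rcases le_total m (1 / 2) with h | h
  · -- `9/20 ≤ m ≤ 1/2`
    have hA : (1 : ℝ) / 12 * (2 * (1 / 2 : ℝ) ^ 12)⁻¹ ≤ 1 / 12 * (2 * m ^ 12)⁻¹ := by gcongr
    have hA' : (170 : ℝ) ≤ 1 / 12 * (2 * (1 / 2 : ℝ) ^ 12)⁻¹ := by norm_num
    have hB : m⁻¹ ^ 6 ≤ (9 / 20 : ℝ)⁻¹ ^ 6 := by gcongr
    have hB' : (9 / 20 : ℝ)⁻¹ ^ 6 ≤ 121 := by norm_num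
    have hC : (2 * (13 / 10) / m + 1) ^ 3 ≤ (2 * (13 / 10) / (9 / 20 : ℝ) + 1) ^ 3 := by gcongr
    have hC' : (2 * (13 / 10) / (9 / 20 : ℝ) + 1) ^ 3 ≤ 312 := by norm_num
    have hD := sharpTail_anti (by norm_num : (0 : ℝ) < 9 / 20) h1 h13
    have hD' : 16 / ((9 / 20 : ℝ) ^ 3 * (13 / 10) ^ 3) + 18 / ((9 / 20 : ℝ) ^ 2 * (13 / 10) ^ 4) +
        36 / (5 * (9 / 20 : ℝ) * (13 / 10) ^ 5) + 1 / (13 / 10 : ℝ) ^ 6 ≤ 116 := by norm_num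
    linarith
  rcases le_total m (11 / 20) with h' | h'
  · -- `1/2 ≤ m ≤ 11/20`
    have hA : (1 : ℝ) / 12 * (2 * (11 / 20 : ℝ) ^ 12)⁻¹ ≤ 1 / 12 * (2 * m ^ 12)⁻¹ := by gcongr
    have hA' : (543 / 10 : ℝ) ≤ 1 / 12 * (2 * (11 / 20 : ℝ) ^ 12)⁻¹ := by norm_num
    have hB : m⁻¹ ^ 6 ≤ (1 / 2 : ℝ)⁻¹ ^ 6 := by gcongr
    have hB' : (1 / 2 : ℝ)⁻¹ ^ 6 ≤ 64 := by norm_num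
    have hC : (2 * (13 / 10) / m + 1) ^ 3 ≤ (2 * (13 / 10) / (1 / 2 : ℝ) + 1) ^ 3 := by gcongr
    have hC' : (2 * (13 / 10) / (1 / 2 : ℝ) + 1) ^ 3 ≤ 2384 / 10 := by norm_num
    have hD := sharpTail_anti (by norm_num : (0 : ℝ) < 1 / 2) h h13
    have hD' : 16 / ((1 / 2 : ℝ) ^ 3 * (13 / 10) ^ 3) + 18 / ((1 / 2 : ℝ) ^ 2 * (13 / 10) ^ 4) +
        36 / (5 * (1 / 2 : ℝ) * (13 / 10) ^ 5) + 1 / (13 / 10 : ℝ) ^ 6 ≤ 876 / 10 := by norm_num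
    linarith
  rcases le_total m (113 / 200) with h'' | h''
  · -- `11/20 ≤ m ≤ 113/200`
    have hA : (1 : ℝ) / 12 * (2 * (113 / 200 : ℝ) ^ 12)⁻¹ ≤ 1 / 12 * (2 * m ^ 12)⁻¹ := by gcongr
    have hA' : (393 / 10 : ℝ) ≤ 1 / 12 * (2 * (113 / 200 : ℝ) ^ 12)⁻¹ := by norm_num
    have hB : m⁻¹ ^ 6 ≤ (11 / 20 : ℝ)⁻¹ ^ 6 := by gcongr
    have hB' : (11 / 20 : ℝ)⁻¹ ^ 6 ≤ 362 / 10 := by norm_num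
    have hC : (2 * (13 / 10) / m + 1) ^ 3 ≤ (2 * (13 / 10) / (11 / 20 : ℝ) + 1) ^ 3 := by gcongr
    have hC' : (2 * (13 / 10) / (11 / 20 : ℝ) + 1) ^ 3 ≤ 1879 / 10 := by norm_num
    have hD := sharpTail_anti (by norm_num : (0 : ℝ) < 11 / 20) h' h13
    have hD' : 16 / ((11 / 20 : ℝ) ^ 3 * (13 / 10) ^ 3) + 18 / ((11 / 20 : ℝ) ^ 2 * (13 / 10) ^ 4) +
        36 / (5 * (11 / 20 : ℝ) * (13 / 10) ^ 5) + 1 / (13 / 10 : ℝ) ^ 6 ≤ 684 / 10 := by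
      norm_num
    linarith
  · -- `113/200 ≤ m ≤ 23/40`
    have hA : (1 : ℝ) / 12 * (2 * (23 / 40 : ℝ) ^ 12)⁻¹ ≤ 1 / 12 * (2 * m ^ 12)⁻¹ := by gcongr
    have hA' : (3185 / 100 : ℝ) ≤ 1 / 12 * (2 * (23 / 40 : ℝ) ^ 12)⁻¹ := by norm_num
    have hB : m⁻¹ ^ 6 ≤ (113 / 200 : ℝ)⁻¹ ^ 6 := by gcongr
    have hB' : (113 / 200 : ℝ)⁻¹ ^ 6 ≤ 308 / 10 := by norm_num
    have hC : (2 * (13 / 10) / m + 1) ^ 3 ≤ (2 * (13 / 10) / (113 / 200 : ℝ) + 1) ^ 3 := by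
      gcongr
    have hC' : (2 * (13 / 10) / (113 / 200 : ℝ) + 1) ^ 3 ≤ 1758 / 10 := by norm_num
    have hD := sharpTail_anti (by norm_num : (0 : ℝ) < 113 / 200) h'' h13
    have hD' : 16 / ((113 / 200 : ℝ) ^ 3 * (13 / 10) ^ 3) +
        18 / ((113 / 200 : ℝ) ^ 2 * (13 / 10) ^ 4) +
        36 / (5 * (113 / 200 : ℝ) * (13 / 10) ^ 5) + 1 / (13 / 10 : ℝ) ^ 6 ≤ 638 / 10 := by
      norm_num
    linarith

/-! ## §28 The separation bootstrap at `23/40` -/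

/-- **The sharp bootstrap.** A `9/20`-separated `Y ⊆ ℝ³` all of whose Lennard-Jones site sums are
`≤ −711/500` is `23/40`-separated.  With `m = inf` of the mutual distances (`9/20 ≤ m < 23/40` if the
conclusion failed), `Y` is `m`-separated; at a pair `a ≠ b` with `dist a b < 2^{1/12} m` (so
`(dist a b)⁻¹² > (2m¹²)⁻¹`, `(dist a b)⁻⁶ ≤ m⁻⁶`, `dist a b ≤ 13/10`) truncate `U_Y(a)` at radius
`13/10` with the SHARP tail (part XIV, `sum_near_sub_sharpTail_le_tsum`): the near sum is
`V_LJ(dist a b)` plus at least `−(#F − 1)/12`, `#F ≤ ((13/5)/m + 1)³ − 1` (`card_near_le`), the tail is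
`≥ −T(m, 13/10)/6`, and `sepSharp_numerics` contradicts `U_Y(a) ≤ −711/500`. [folklore] -/
theorem sepSharp {Y : Set E3} (hsep : ∀ p ∈ Y, ∀ q ∈ Y, p ≠ q → 9 / 20 ≤ dist p q)
    (hU : ∀ p ∈ Y, ∑' q : {q : E3 // q ∈ Y ∧ q ≠ p}, lennardJones (dist p q.1) ≤ -(711 / 500)) :
    ∀ p ∈ Y, ∀ q ∈ Y, p ≠ q → 23 / 40 ≤ dist p q := by
  classical
  by_contra hcon
  push Not at hcon
  obtain ⟨p₀, hp₀, q₀, hq₀, hne₀, hlt₀⟩ := hcon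
  -- the infimum `m` of the mutual distances
  set S : Set ℝ := {r | ∃ a ∈ Y, ∃ b ∈ Y, a ≠ b ∧ r = dist a b} with hS
  have hSne : S.Nonempty := ⟨dist p₀ q₀, p₀, hp₀, q₀, hq₀, hne₀, rfl⟩
  have hSbdd : BddBelow S :=
    ⟨9 / 20, by rintro r ⟨a, ha, b, hb, hab, rfl⟩; exact hsep a ha b hb hab⟩
  set m : ℝ := sInf S with hm
  have h9m : 9 / 20 ≤ m :=
    le_csInf hSne (by rintro r ⟨a, ha, b, hb, hab, rfl⟩; exact hsep a ha b hb hab)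
  have hm0 : 0 < m := by linarith
  have hmsep : ∀ a ∈ Y, ∀ b ∈ Y, a ≠ b → m ≤ dist a b := fun a ha b hb hab =>
    csInf_le hSbdd ⟨a, ha, b, hb, hab, rfl⟩
  have hm23 : m < 23 / 40 := (csInf_le hSbdd ⟨p₀, hp₀, q₀, hq₀, hne₀, rfl⟩).trans_lt hlt₀
  -- a pair at distance `< 2^{1/12} m`
  set c : ℝ := (2 : ℝ) ^ ((1 : ℝ) / 12) with hc
  have hc1 : 1 < c := Real.one_lt_rpow (by norm_num) (by norm_num)
  have hc12 : c ^ 12 = 2 := by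
    rw [show (c ^ 12 : ℝ) = c ^ ((12 : ℕ) : ℝ) from (Real.rpow_natCast c 12).symm, hc,
      ← Real.rpow_mul (by norm_num : (0 : ℝ) ≤ 2)]
    norm_num
  have hmc : m < m * c := lt_mul_right hm0 hc1
  obtain ⟨r, ⟨a, ha, b, hb, hab, rfl⟩, hr⟩ := exists_lt_of_csInf_lt hSne (hm ▸ hmc)
  -- the distinguished distance `dist a b`
  have hdm : m ≤ dist a b := hmsep a ha b hb hab
  have hd0 : 0 < dist a b := hm0.trans_le hdm
  have hd12 : (dist a b) ^ 12 < 2 * m ^ 12 := by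
    calc (dist a b) ^ 12 < (m * c) ^ 12 := pow_lt_pow_left₀ hr dist_nonneg (by norm_num)
      _ = 2 * m ^ 12 := by rw [mul_pow, hc12]; ring
  have hinv12 : (2 * m ^ 12)⁻¹ < (dist a b)⁻¹ ^ 12 := by
    rw [inv_pow]
    exact (inv_lt_inv₀ (by positivity) (by positivity)).2 hd12
  have hinv6 : (dist a b)⁻¹ ^ 6 ≤ m⁻¹ ^ 6 := by
    gcongr
  have hd13 : dist a b ≤ 13 / 10 := by
    by_contra h
    push Not at h
    have h1 : (13 / 10 : ℝ) ^ 12 ≤ (dist a b) ^ 12 := pow_le_pow_left₀ (by norm_num) h.le 12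
    have h2 : m ^ 12 ≤ (23 / 40 : ℝ) ^ 12 := pow_le_pow_left₀ hm0.le hm23.le 12
    norm_num at h1 h2
    linarith
  -- truncation of the site sum at `a` at radius `13/10`, sharp tail
  obtain ⟨F, hF⟩ := exists_finset_near hm0 hmsep a (13 / 10 : ℝ)
  have hlow := sum_near_sub_sharpTail_le_tsum hm0 hmsep a (by norm_num : (0 : ℝ) < 13 / 10) F hF
  have hcard := card_near_le hm0 hmsep ha (by norm_num : (0 : ℝ) ≤ 13 / 10) F hF
  have hbF : b ∈ F := (hF b).2 ⟨hb, Ne.symm hab, by rw [dist_comm]; exact hd13⟩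
  have hsplit : ∑ q ∈ F, lennardJones (dist a q) =
      lennardJones (dist a b) + ∑ q ∈ F.erase b, lennardJones (dist a q) :=
    (Finset.add_sum_erase F (fun q => lennardJones (dist a q)) hbF).symm
  have hrest := neg_card_div_le_sum_lennardJones (F.erase b) fun q => dist a q
  have hcardE : ((F.erase b).card : ℝ) + 1 = F.card := by
    exact_mod_cast Finset.card_erase_add_one hbF
  have hV : lennardJones (dist a b) =
      1 / 12 * (dist a b)⁻¹ ^ 12 - 1 / 6 * (dist a b)⁻¹ ^ 6 := rfl
  have hnum := sepSharp_numerics h9m hm23.le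
  have hUa := hU a ha
  rw [hsplit, hV] at hlow
  linarith

/-- **Composite bootstrap.** A `1/4`-separated `Y ⊆ ℝ³` all of whose Lennard-Jones site sums are
`≤ −711/500` is `23/40`-separated (the landed `(SEP)` `stub_sepBootstrap` gives `9/20`, then
`sepSharp`). [folklore] -/
theorem sep_of_quarter_sharp {Y : Set E3} (hsep : ∀ p ∈ Y, ∀ q ∈ Y, p ≠ q → 1 / 4 ≤ dist p q)
    (hU : ∀ p ∈ Y, ∑' q : {q : E3 // q ∈ Y ∧ q ≠ p}, lennardJones (dist p q.1) ≤ -(711 / 500)) :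
    ∀ p ∈ Y, ∀ q ∈ Y, p ≠ q → 23 / 40 ≤ dist p q :=
  sepSharp (stub_sepBootstrap Y hsep hU) hU

/-! ## Registered sub-goal of `stub_localHalfSpaceCert`: the sharp separation bootstrap -/

/-- **Sub-goal `stub_local_sepSharp` of the stub `stub_localHalfSpaceCert`** (registered on
stmt-AtomisticToContinuum-15099): a `9/20`-separated `Y ⊆ ℝ³` all of whose Lennard-Jones site sums
are `≤ −711/500` is `23/40`-separated (`sepSharp` in arrow form) — so `(LOCAL)` may be posed at
separation `23/40`. [folklore] -/
theorem stub_local_sepSharp :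
    ∀ Y : Set (EuclideanSpace ℝ (Fin 3)),
      (∀ p ∈ Y, ∀ q ∈ Y, p ≠ q → 9 / 20 ≤ dist p q) →
      (∀ p ∈ Y, ∑' q : {q : EuclideanSpace ℝ (Fin 3) // q ∈ Y ∧ q ≠ p},
          lennardJones (dist p q.1) ≤ -(711 / 500)) →
      ∀ p ∈ Y, ∀ q ∈ Y, p ≠ q → 23 / 40 ≤ dist p q :=
  fun _ hsep hU => sepSharp hsep hU

end Summit.AtomisticToContinuum.Crystallization.Theorems.PerronTransitivityUniformBindingRigidity

end
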